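import Mathlib
import HarnessLib
import Literature.Analysis.FluidPDE.Tao2016AveragedNS.LocalCascadeSolutions
import Literature.Analysis.FluidPDE.Tao2016AveragedNS.RenormalisedCascadeWaves
import Literature.Analysis.FluidPDE.Tao2016AveragedNS.SelfSimilarCascadeBlowup
import Literature.Analysis.FluidPDE.Tao2016AveragedNS.ViscousEternalSolutions
import Literature.Analysis.FluidPDE.Tao2016AveragedNS.BoundedEternalSolutions
import Summits.NavierStokesRegularity.NavierStokesRegularity.Theses.TaoLadderRungTwoBreak
import Summits.NavierStokesRegularity.NavierStokesRegularity.Theorems.TaoLadderRungTwoBreakNoSurvivingEternalViscBddOneSmallActionRung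
import Summits.NavierStokesRegularity.NavierStokesRegularity.Theorems.TaoLadderRungTwoBreakNoSurvivingEternalViscBddOneWeightedGrowth
import Summits.NavierStokesRegularity.NavierStokesRegularity.Theorems.TaoLadderRungTwoBreakNoSurvivingEternalViscBddOneSurvivorEnergyBound
import Summits.NavierStokesRegularity.NavierStokesRegularity.Theorems.TaoLadderRungTwoBreakNoSurvivingEternalViscBddOneSurvivorAmplitudeFloor

/-!
# The `1/ε₀` amplitude floor of bounded survivors, TAIL FORM (I): the growth law and the floor with the amplitude bound on the
# shells `k ≥ 0` only — crux K1ᵛ(1) `TaoLadderRungTwoBreak.NoSurvivingEternalViscBddOne` ⟨20419⟩ (children (ρ0) ⟨20451⟩ / (ρ+) ⟨20452⟩)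

MODEL lattice ODEs only (Tao 2016 §4, §6.4; cell vocabulary `IsEternalVisc`, `UniformBound`, `physEnergy`, `physFlux`, `EternalSurvivingFwd`);
nothing here is a statement about the Navier–Stokes equations; no stub, crux or summit is closed (`--supports stmt-NavierStokesRegularity-20419`).

The companion files `…SurvivorEnergyBound` / `…SurvivorAmplitudeFloor` prove `4Λ ≤ 7·C_A·B·(Λ²−1)` for every forward-(S₁)-surviving
admissible eternal solution with `‖W_k(σ)‖ ≤ B` for ALL shells `k ∈ ℤ`.  Only the shells `k ≥ 0` (and the energy of shell `−1`)
enter the mechanism, so the same floor holds with `B` = the amplitude bound on the shells `k ≥ 0` alone, the solution being merely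
uniformly bounded (by any constant) below:
* `physEnergy_le_exp_tail`, `weightedSum_growth_tail`, `weightedSum_le_tail` — the tree's growth law (`…WeightedGrowth`) VERBATIM with
  the hypothesis weakened to `∀ k ≥ 0, ‖W_k‖ ≤ B`;
* **`survivor_amplitude_floor_tail0`** — `UniformBound W`, `‖W_k(σ)‖ ≤ B` for `k ≥ 0`, (S₁)-surviving ⟹ `4Λ ≤ 7·C_A·B·(Λ²−1)`.
The shift-covariant consequence (the floor on EVERY tail `k ≥ n₀`: survivors STAY tall) is in `…SurvivorTailFloor`.
HONEST LABEL: (ρ0), (ρ+), ⟨20419⟩ and every NS statement remain OPEN; rung 0.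
-/

noncomputable section

-- the summit and its single sub-problem share the name (CONVENTIONS §1)
set_option linter.dupNamespace false

namespace Summit.NavierStokesRegularity.NavierStokesRegularity.Theorems.NoSurvivingEternalViscBddOne.SurvivorTailGrowth

open Set Filter Topology MeasureTheory
open scoped RealInnerProductSpace
open Literature.Analysis.FluidPDE Literature.Analysis.FluidPDE.TaoCascade
open Summit.NavierStokesRegularity.NavierStokesRegularity.Theses.TaoLadderRungTwoBreak
open Summit.NavierStokesRegularity.NavierStokesRegularity.Theorems.NoSurvivingEternalViscBddOne.SmallAction
open Summit.NavierStokesRegularity.NavierStokesRegularity.Theorems.NoSurvivingEternalViscBddOne.WeightedGrowth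
open Summit.NavierStokesRegularity.NavierStokesRegularity.Theorems.NoSurvivingEternalViscBddOne.SurvivorEnergyBound
open Summit.NavierStokesRegularity.NavierStokesRegularity.Theorems.NoSurvivingEternalViscBddOne.SurvivorAmplitudeFloor

variable {m : ℕ} {ε₀ νh : ℝ} {α : Fin m → Fin m → Fin m → ℤ × ℤ × ℤ → ℝ} {W : ℤ → ℝ → Em m}

/-! ## §1 The growth law with the amplitude bound on the shells `k ≥ 0` only -/

/-- `E_k(σ) ≤ Λ^{-2k} B² e^{2σ}` for `k ≥ 0` under `‖W_k‖ ≤ B` (`k ≥ 0`). [cite: Tao2016AveragedNS, §4 Lemma 4.1 (4.10), §6.4; elementary] -/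
theorem physEnergy_le_exp_tail (hε : 0 < ε₀) {B : ℝ} (hB : ∀ k : ℤ, 0 ≤ k → ∀ σ, ‖W k σ‖ ≤ B)
    {k : ℤ} (hk : 0 ≤ k) (σ : ℝ) :
    physEnergy ε₀ W k σ ≤ (bigLam ε₀ ^ k)⁻¹ ^ 2 * B ^ 2 * Real.exp (2 * σ) := by
  have hΛ : 0 < bigLam ε₀ ^ k := zpow_pos (bigLam_pos (by linarith)) k
  have h0 : 0 ≤ ‖W k σ‖ := norm_nonneg _
  have h1 : ‖W k σ‖ ^ 2 ≤ B ^ 2 := pow_le_pow_left₀ h0 (hB k hk σ) 2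
  unfold physEnergy
  calc (bigLam ε₀ ^ k)⁻¹ ^ 2 * (Real.exp (2 * σ) * ‖W k σ‖ ^ 2)
      ≤ (bigLam ε₀ ^ k)⁻¹ ^ 2 * (Real.exp (2 * σ) * B ^ 2) :=
        mul_le_mul_of_nonneg_left (mul_le_mul_of_nonneg_left h1 (Real.exp_pos _).le) (by positivity)
    _ = (bigLam ε₀ ^ k)⁻¹ ^ 2 * B ^ 2 * Real.exp (2 * σ) := by ring

/-- **The growth law on `[σ₀, σ]`, TAIL form** (the amplitude bound is assumed on the shells `k ≥ 0` only; verbatim the tree's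
`weightedSum_growth` otherwise).  For an admissible eternal solution (any `ν̂ ≥ 0`) of a cancelling table with `‖W‖ ≤ B`,
`E₋₁ ≤ A` at all log-times and a weight `θ ≥ 1`:
`Σ_{i≤N}θⁱE_i(σ) ≤ (Σ_{i≤N}θⁱE_i(σ₀) + (c·A + c·θᴺΛ^{−2N}B²e^{2σ})(σ−σ₀)) · e^{(θ−1)c(σ−σ₀)}`, `c = 2C_AB/Λ`
(feed from shell `−1`, leak through the top bond, and the `θ−1` amplification of the telescoped interior fluxes).
[cite: Tao2016AveragedNS, §4 Lemma 4.1 (4.8)–(4.10) with (4.3), the viscous equation before Thm. 4.2, §6.4; this file] -/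
theorem weightedSum_growth_tail (hε : 0 < ε₀) (hW : IsEternalVisc ε₀ νh α W) (hc : IsCancellingCoeff α)
    {B : ℝ} (hB : ∀ k : ℤ, 0 ≤ k → ∀ σ, ‖W k σ‖ ≤ B) {θ : ℝ} (hθ1 : 1 ≤ θ) {A : ℝ}
    (hA : ∀ σ, physEnergy ε₀ W (-1) σ ≤ A) (N : ℕ) {σ₀ σ : ℝ} (hle : σ₀ ≤ σ) :
    ∑ i ∈ Finset.range (N + 1), θ ^ i * physEnergy ε₀ W i σ
      ≤ (∑ i ∈ Finset.range (N + 1), θ ^ i * physEnergy ε₀ W i σ₀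
          + (2 * fluxConst α * (bigLam ε₀)⁻¹ * B * A
              + 2 * fluxConst α * (bigLam ε₀)⁻¹ * B
                * (θ ^ N * ((bigLam ε₀ ^ (N : ℤ))⁻¹ ^ 2 * B ^ 2 * Real.exp (2 * σ)))) * (σ - σ₀))
        * Real.exp ((θ - 1) * (2 * fluxConst α * (bigLam ε₀)⁻¹ * B) * (σ - σ₀)) := by
  set c : ℝ := 2 * fluxConst α * (bigLam ε₀)⁻¹ * B with hcdef
  have hΛ : 0 < bigLam ε₀ := bigLam_pos (by linarith)
  have hB0 : 0 ≤ B := (norm_nonneg _).trans (hB 0 le_rfl 0)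
  have hC0 := fluxConst_nonneg α
  have hc0 : 0 ≤ c := by positivity
  have hA0 : 0 ≤ A := (physEnergy_nonneg ε₀ W (-1) 0).trans (hA 0)
  set S : ℝ := (bigLam ε₀ ^ (N : ℤ))⁻¹ ^ 2 * B ^ 2 * Real.exp (2 * σ) with hS
  have hS0 : 0 ≤ S := by positivity
  have hθ0 : 0 ≤ θ := zero_le_one.trans hθ1
  set K : ℝ := (θ - 1) * c with hK
  have hK0 : 0 ≤ K := mul_nonneg (by linarith) hc0
  set ε : ℝ := c * A + c * (θ ^ N * S) with hεdef
  have hε0' : 0 ≤ ε := by positivity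
  set f : ℝ → ℝ := fun x => ∑ i ∈ Finset.range (N + 1), θ ^ i * physEnergy ε₀ W i x with hf
  set f' : ℝ → ℝ := fun s => physFlux ε₀ α W (-1) s + (θ - 1) * ∑ i ∈ Finset.range N, θ ^ i * physFlux ε₀ α W i s
        - θ ^ N * physFlux ε₀ α W N s
        - ∑ i ∈ Finset.range (N + 1), θ ^ i * (2 * viscCoef ε₀ νh i s * physEnergy ε₀ W i s) with hf'
  have hderiv : ∀ s, HasDerivAt f (f' s) s := fun s => hasDerivAt_weightedSum hε hW hc θ N s
  have hcont : ContinuousOn f (Icc σ₀ σ) := fun s _ => (hderiv s).continuousAt.continuousWithinAt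
  have hf0 : ∀ s, 0 ≤ f s := fun s =>
    Finset.sum_nonneg fun i _ => mul_nonneg (pow_nonneg hθ0 i) (physEnergy_nonneg ε₀ W _ s)
  -- every bond flux is at most `c·E`
  have hFc : ∀ (k : ℤ), -1 ≤ k → ∀ (s : ℝ), |physFlux ε₀ α W k s| ≤ c * physEnergy ε₀ W k s := fun k hk s =>
    (abs_physFlux_le hε hc W k s).trans (by
      rw [hcdef]
      exact mul_le_mul_of_nonneg_right (mul_le_mul_of_nonneg_left (hB _ (by omega) s) (by positivity))
        (physEnergy_nonneg ε₀ W _ s))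
  have hbound : ∀ s ∈ Ico σ₀ σ, f' s ≤ K * f s + ε := by
    intro s hs
    have h1 : physFlux ε₀ α W (-1) s ≤ c * A :=
      ((le_abs_self _).trans (hFc (-1) le_rfl s)).trans (mul_le_mul_of_nonneg_left (hA s) hc0)
    have h2 : (θ - 1) * ∑ i ∈ Finset.range N, θ ^ i * physFlux ε₀ α W i s ≤ K * f s := by
      have hsum : ∑ i ∈ Finset.range N, θ ^ i * physFlux ε₀ α W i s
          ≤ c * ∑ i ∈ Finset.range N, θ ^ i * physEnergy ε₀ W i s := by
        rw [Finset.mul_sum]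
        refine Finset.sum_le_sum fun i _ => ?_
        have := mul_le_mul_of_nonneg_left ((le_abs_self _).trans (hFc i (by omega) s)) (pow_nonneg hθ0 i)
        linarith
      have hsub : ∑ i ∈ Finset.range N, θ ^ i * physEnergy ε₀ W i s ≤ f s :=
        Finset.sum_le_sum_of_subset_of_nonneg (Finset.range_mono (Nat.le_succ N))
          fun i _ _ => mul_nonneg (pow_nonneg hθ0 i) (physEnergy_nonneg ε₀ W _ s)
      have hθ1' : 0 ≤ θ - 1 := by linarith
      calc (θ - 1) * ∑ i ∈ Finset.range N, θ ^ i * physFlux ε₀ α W i s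
          ≤ (θ - 1) * (c * f s) := mul_le_mul_of_nonneg_left (hsum.trans (mul_le_mul_of_nonneg_left hsub hc0)) hθ1'
        _ = K * f s := by rw [hK]; ring
    have h3 : -(θ ^ N * physFlux ε₀ α W N s) ≤ c * (θ ^ N * S) := by
      have hEN : physEnergy ε₀ W N s ≤ S := (physEnergy_le_exp_tail hε hB (Int.natCast_nonneg N) s).trans
        (mul_le_mul_of_nonneg_left (Real.exp_le_exp.2 (by linarith [hs.2])) (by positivity))
      have := mul_le_mul_of_nonneg_left (((neg_le_abs _).trans (hFc N (by omega) s)).trans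
        (mul_le_mul_of_nonneg_left hEN hc0)) (pow_nonneg hθ0 N)
      linarith
    have h4 : 0 ≤ ∑ i ∈ Finset.range (N + 1), θ ^ i * (2 * viscCoef ε₀ νh i s * physEnergy ε₀ W i s) :=
      Finset.sum_nonneg fun i _ => mul_nonneg (pow_nonneg hθ0 i)
        (mul_nonneg (mul_nonneg two_pos.le (viscCoef_nonneg hε hW.nonneg _ _)) (physEnergy_nonneg ε₀ W _ s))
    simp only [hf', hεdef]
    linarith
  have hgr := le_gronwallBound_of_liminf_deriv_right_le (f := f) (f' := f') (δ := f σ₀) (K := K) (ε := ε)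
    (a := σ₀) (b := σ) hcont
    (fun s _ r hr => ((hderiv s).hasDerivWithinAt.liminf_right_slope_le hr).mono fun z hz => by
      simpa only [slope_def_field, div_eq_inv_mul] using hz)
    le_rfl hbound σ ⟨hle, le_rfl⟩
  have hfin := hgr.trans (Literature.Analysis.FluidPDE.PerturbedEnergyInequality.gronwallBound_le (hf0 σ₀) hK0 hε0' (by linarith))
  simpa only [hf, hK, hεdef, hS, hcdef] using hfin

/-- **THE WEIGHTED-ENERGY GROWTH LAW, TAIL form** (amplitude bound on the shells `k ≥ 0` only; verbatim the tree's `weightedSum_le`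
otherwise).  For a uniformly bounded (`‖W‖ ≤ B`) admissible eternal solution (any `ν̂ ≥ 0`) of a
cancelling table, `E₋₁ ≤ A` at all log-times, and a weight `1 ≤ θ < Λ²`: for all `N` and `σ₀ ≤ σ`,
`Σ_{i≤N} θⁱE_i(σ) ≤ (B²e^{2σ₀}/(1 − θ/Λ²) + (2C_AB/Λ)·A·(σ−σ₀)) · exp((θ−1)(2C_AB/Λ)(σ−σ₀))`
(the top leak is sent to `N → ∞`; at `θ = 1+ε₀` the rate is `ε₀·2C_AB/Λ`).
[cite: Tao2016AveragedNS, §4 Lemma 4.1 (4.8)–(4.10) with (4.3), the viscous equation before Thm. 4.2, §6.4; this file] -/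
theorem weightedSum_le_tail (hε : 0 < ε₀) (hW : IsEternalVisc ε₀ νh α W) (hc : IsCancellingCoeff α)
    {B : ℝ} (hB : ∀ k : ℤ, 0 ≤ k → ∀ σ, ‖W k σ‖ ≤ B) {θ : ℝ} (hθ1 : 1 ≤ θ) (hθ2 : θ < bigLam ε₀ ^ 2) {A : ℝ}
    (hA : ∀ σ, physEnergy ε₀ W (-1) σ ≤ A) (N : ℕ) {σ₀ σ : ℝ} (hle : σ₀ ≤ σ) :
    ∑ i ∈ Finset.range (N + 1), θ ^ i * physEnergy ε₀ W i σ
      ≤ (B ^ 2 * Real.exp (2 * σ₀) / (1 - θ / bigLam ε₀ ^ 2)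
          + 2 * fluxConst α * (bigLam ε₀)⁻¹ * B * A * (σ - σ₀))
        * Real.exp ((θ - 1) * (2 * fluxConst α * (bigLam ε₀)⁻¹ * B) * (σ - σ₀)) := by
  set c : ℝ := 2 * fluxConst α * (bigLam ε₀)⁻¹ * B with hcdef
  have hΛ : 0 < bigLam ε₀ := bigLam_pos (by linarith)
  have hΛ2 : 0 < bigLam ε₀ ^ 2 := by positivity
  have hB0 : 0 ≤ B := (norm_nonneg _).trans (hB 0 le_rfl 0)
  have hC0 := fluxConst_nonneg α
  have hc0 : 0 ≤ c := by positivity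
  have hA0 : 0 ≤ A := (physEnergy_nonneg ε₀ W (-1) 0).trans (hA 0)
  have hθ0 : 0 ≤ θ := zero_le_one.trans hθ1
  set q : ℝ := θ / bigLam ε₀ ^ 2 with hq
  have hq0 : 0 ≤ q := by positivity
  have hq1 : q < 1 := (div_lt_one hΛ2).2 hθ2
  set δ₀ : ℝ := B ^ 2 * Real.exp (2 * σ₀) / (1 - q) with hδ₀
  set G : ℝ := Real.exp ((θ - 1) * c * (σ - σ₀)) with hG
  have hG0 : 0 ≤ G := (Real.exp_pos _).le
  have hsplit : ∀ N : ℕ, θ ^ N * ((bigLam ε₀ ^ (N : ℤ))⁻¹ ^ 2) = q ^ N := fun N => by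
    rw [zpow_natCast, hq, div_pow]; field_simp; ring
  -- the initial weighted sum is a geometric series
  have hinit : ∀ N' : ℕ, ∑ i ∈ Finset.range (N' + 1), θ ^ i * physEnergy ε₀ W i σ₀ ≤ δ₀ := by
    intro N'
    have hterm : ∀ i ∈ Finset.range (N' + 1), θ ^ i * physEnergy ε₀ W i σ₀ ≤ B ^ 2 * Real.exp (2 * σ₀) * q ^ i := by
      intro i _
      rw [← hsplit i]
      have h := mul_le_mul_of_nonneg_left (physEnergy_le_exp_tail hε hB (Int.natCast_nonneg i) σ₀) (pow_nonneg hθ0 i)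
      linarith
    refine (Finset.sum_le_sum hterm).trans ?_
    rw [← Finset.mul_sum, hδ₀, div_eq_mul_one_div]
    have hgeom := geom_sum_Ico_le_of_lt_one hq0 hq1 (m := 0) (n := N' + 1)
    rw [pow_zero, ← Finset.range_eq_Ico] at hgeom
    exact mul_le_mul_of_nonneg_left hgeom (by positivity)
  -- the bound with the top leak of the larger sum `N' ≥ N`
  have hN' : ∀ N' : ℕ, N ≤ N' → ∑ i ∈ Finset.range (N + 1), θ ^ i * physEnergy ε₀ W i σ
      ≤ (δ₀ + (c * A + c * (q ^ N' * B ^ 2 * Real.exp (2 * σ))) * (σ - σ₀)) * G := by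
    intro N' hNN'
    have hsub : ∑ i ∈ Finset.range (N + 1), θ ^ i * physEnergy ε₀ W i σ
        ≤ ∑ i ∈ Finset.range (N' + 1), θ ^ i * physEnergy ε₀ W i σ :=
      Finset.sum_le_sum_of_subset_of_nonneg (Finset.range_mono (by omega))
        fun i _ _ => mul_nonneg (pow_nonneg hθ0 i) (physEnergy_nonneg ε₀ W _ σ)
    have h := weightedSum_growth_tail hε hW hc hB hθ1 hA N' hle
    have hleak : θ ^ N' * ((bigLam ε₀ ^ (N' : ℤ))⁻¹ ^ 2 * B ^ 2 * Real.exp (2 * σ))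
        = q ^ N' * B ^ 2 * Real.exp (2 * σ) := by
      rw [← hsplit N']; ring
    rw [hleak] at h
    refine hsub.trans (h.trans ?_)
    rw [← hcdef]
    exact mul_le_mul_of_nonneg_right (by linarith [hinit N']) hG0
  -- let `N' → ∞`
  have hg : Continuous fun t : ℝ => (δ₀ + (c * A + c * (t * B ^ 2 * Real.exp (2 * σ))) * (σ - σ₀)) * G := by
    fun_prop
  have hlim := (hg.tendsto 0).comp (tendsto_pow_atTop_nhds_zero_of_lt_one hq0 hq1)
  have hmain := ge_of_tendsto hlim ((eventually_ge_atTop N).mono fun N' hNN' => hN' N' hNN')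
  simpa only [zero_mul, mul_zero, add_zero] using hmain

/-! ## §2 The amplitude floor with the bound on the shells `k ≥ 0` only -/

/-- **THE `1/ε₀` AMPLITUDE FLOOR, bound on the shells `k ≥ 0` only.**  A uniformly bounded, forward-(S₁)-surviving admissible
eternal solution (any `ν̂ ≥ 0`) of a CANCELLING table with `‖W_k(σ)‖ ≤ B` for all `k ≥ 0` satisfies `4Λ ≤ 7·C_A·B·(Λ²−1)` —
the proof of `survivor_amplitude_floor` verbatim with `weightedSum_le_tail` (the uniform bound below shell `0` only enters through
the finite constants `K`, `A`, which the asymptotics in `n` discard).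
[cite: Tao2016AveragedNS, §4 Lemma 4.1 (4.8)–(4.10) with (4.3), the viscous equation before Thm. 4.2, §6.4; this file] -/
theorem survivor_amplitude_floor_tail0 (hε : 0 < ε₀) (hW : IsEternalVisc ε₀ νh α W) (hc : IsCancellingCoeff α)
    (hU : UniformBound W) {B : ℝ} (hB : ∀ k : ℤ, 0 ≤ k → ∀ σ, ‖W k σ‖ ≤ B) (hS : EternalSurvivingFwd 1 ε₀ W) :
    4 * bigLam ε₀ ≤ 7 * fluxConst α * B * (bigLam ε₀ ^ 2 - 1) := by
  have h1ε : 0 < 1 + ε₀ := by linarith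
  have hΛ : 0 < bigLam ε₀ := bigLam_pos (by linarith)
  have hΛ1 : 1 < bigLam ε₀ := by unfold bigLam; exact Real.one_lt_rpow (by linarith) (by norm_num)
  have hΛ2 : 1 < bigLam ε₀ ^ 2 := by nlinarith
  have hB0 : 0 ≤ B := (norm_nonneg _).trans (hB 0 le_rfl 0)
  have hC0 := fluxConst_nonneg α
  set ℓ : ℝ := Real.log (1 + ε₀) with hℓ
  have hℓ0 : 0 < ℓ := Real.log_pos (by linarith)
  have hlogΛ : Real.log (bigLam ε₀) = 5 / 2 * ℓ := by
    rw [hℓ]; unfold bigLam; rw [Real.log_rpow h1ε]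
  set c : ℝ := 2 * fluxConst α * (bigLam ε₀)⁻¹ * B with hcdef
  have hc0 : 0 ≤ c := by positivity
  by_contra hlt
  push Not at hlt
  -- STEP 1: the margin at `θ = Λ²` and the choice of `θ < Λ²`
  have hval : 0 < Real.log (bigLam ε₀ ^ 2) - ℓ - 7 / 2 * ℓ * ((bigLam ε₀ ^ 2 - 1) * c) := by
    rw [Real.log_pow, hlogΛ]
    push_cast
    have h1 : (bigLam ε₀ ^ 2 - 1) * c = 2 * (fluxConst α * B * (bigLam ε₀ ^ 2 - 1)) / bigLam ε₀ := by
      rw [hcdef]; field_simp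
    have h2 : 7 / 2 * ((bigLam ε₀ ^ 2 - 1) * c) < 4 := by
      rw [h1, show 7 / 2 * (2 * (fluxConst α * B * (bigLam ε₀ ^ 2 - 1)) / bigLam ε₀)
        = (7 * fluxConst α * B * (bigLam ε₀ ^ 2 - 1)) / bigLam ε₀ by ring, div_lt_iff₀ hΛ]
      linarith
    nlinarith [mul_pos hℓ0 (sub_pos.2 h2)]
  have hcont : ContinuousAt (fun θ => Real.log θ - ℓ - 7 / 2 * ℓ * ((θ - 1) * c)) (bigLam ε₀ ^ 2) := by
    have : bigLam ε₀ ^ 2 ≠ 0 := by positivity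
    fun_prop (disch := exact this)
  have hev : ∀ᶠ θ in 𝓝 (bigLam ε₀ ^ 2), 0 < Real.log θ - ℓ - 7 / 2 * ℓ * ((θ - 1) * c) :=
    hcont.eventually (lt_mem_nhds hval)
  have hev3 : ∀ᶠ θ in 𝓝[<] (bigLam ε₀ ^ 2), θ ∈ Ioo 1 (bigLam ε₀ ^ 2) := Ioo_mem_nhdsLT hΛ2
  have hev2 : ∀ᶠ θ in 𝓝[<] (bigLam ε₀ ^ 2),
      0 < Real.log θ - ℓ - 7 / 2 * ℓ * ((θ - 1) * c) ∧ θ ∈ Ioo 1 (bigLam ε₀ ^ 2) :=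
    (hev.filter_mono nhdsWithin_le_nhds).and hev3
  obtain ⟨θ, hθpos, hθ1, hθ2⟩ := hev2.exists
  have hθ0 : 0 < θ := by linarith
  set L₁ : ℝ := Real.log θ - ℓ with hL₁
  set r : ℝ := (θ - 1) * c with hr
  have hr0 : 0 ≤ r := mul_nonneg (by linarith) hc0
  set g₀ : ℝ := L₁ - 7 / 2 * ℓ * r with hg₀
  have hg₀0 : 0 < g₀ := hθpos
  have hL₁0 : 0 < L₁ := by nlinarith [mul_nonneg hℓ0.le hr0]
  set η : ℝ := g₀ / (7 * ℓ) with hη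
  have hη0 : 0 < η := by positivity
  set ρ : ℝ := r + η with hρ
  have hρ0 : 0 < ρ := by linarith
  have hkey : 7 / 2 * ℓ * ρ < L₁ := by
    have e1 : 7 / 2 * ℓ * η = g₀ / 2 := by
      rw [hη]; field_simp
    have e2 : 7 / 2 * ℓ * ρ = 7 / 2 * ℓ * r + g₀ / 2 := by rw [hρ, mul_add, e1]
    rw [e2]; linarith
  -- STEP 2: data of the solution
  obtain ⟨K, hK0, hK⟩ := exists_uniform_physEnergy_le hε hW hc hU
  obtain ⟨A, hA⟩ := exists_physEnergy_le hε hW hU (-1)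
  have hA0 : 0 ≤ A := (physEnergy_nonneg ε₀ W (-1) 0).trans (hA 0)
  have h1q : 0 < 1 - θ / bigLam ε₀ ^ 2 := by
    rw [sub_pos, div_lt_one (by positivity)]; exact hθ2
  set δ₀ : ℝ := B ^ 2 / (1 - θ / bigLam ε₀ ^ 2) with hδ₀
  have hδ₀0 : 0 ≤ δ₀ := by positivity
  set D : ℝ := δ₀ + c * A / η + 1 with hD
  have hD0 : 0 < D := by positivity
  -- the growth law, absorbed into one exponential: `θⁿE_n(σ) ≤ D e^{ρσ}` for `σ ≥ 0`
  have hgrowth : ∀ (n : ℕ) (σ : ℝ), 0 ≤ σ → θ ^ n * physEnergy ε₀ W n σ ≤ D * Real.exp (ρ * σ) := by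
    intro n σ hσ
    have h := weightedSum_le_tail hε hW hc hB hθ1.le hθ2 hA n hσ
    simp only [sub_zero, mul_zero, Real.exp_zero, mul_one] at h
    rw [← hcdef, ← hδ₀] at h
    have hsingle : θ ^ n * physEnergy ε₀ W n σ ≤ ∑ i ∈ Finset.range (n + 1), θ ^ i * physEnergy ε₀ W i σ :=
      Finset.single_le_sum (f := fun i : ℕ => θ ^ i * physEnergy ε₀ W i σ)
        (fun i _ => mul_nonneg (pow_nonneg hθ0.le i) (physEnergy_nonneg ε₀ W _ _))
        (Finset.mem_range.2 (Nat.lt_succ_self n))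
    have he1 : 1 ≤ Real.exp (η * σ) := Real.one_le_exp (by positivity)
    have he2 : η * σ ≤ Real.exp (η * σ) := by have := Real.add_one_le_exp (η * σ); linarith
    have hlin : δ₀ + c * A * σ ≤ (δ₀ + c * A / η) * Real.exp (η * σ) := by
      have h3 : c * A * σ ≤ c * A / η * Real.exp (η * σ) := by
        rw [div_mul_eq_mul_div, le_div_iff₀ hη0]
        have := mul_le_mul_of_nonneg_left he2 (mul_nonneg hc0 hA0)
        linarith
      have h4 : δ₀ ≤ δ₀ * Real.exp (η * σ) := le_mul_of_one_le_right hδ₀0 he1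
      linarith
    have hexp : Real.exp (η * σ) * Real.exp ((θ - 1) * c * σ) = Real.exp (ρ * σ) := by
      rw [← Real.exp_add, hρ, hr]; ring_nf
    have hE0 : 0 ≤ Real.exp ((θ - 1) * c * σ) := (Real.exp_pos _).le
    calc θ ^ n * physEnergy ε₀ W n σ
        ≤ (δ₀ + c * A * σ) * Real.exp ((θ - 1) * c * σ) := hsingle.trans h
      _ ≤ (δ₀ + c * A / η) * Real.exp (η * σ) * Real.exp ((θ - 1) * c * σ) :=
          mul_le_mul_of_nonneg_right hlin hE0
      _ = (δ₀ + c * A / η) * Real.exp (ρ * σ) := by rw [mul_assoc, hexp]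
      _ ≤ D * Real.exp (ρ * σ) := mul_le_mul_of_nonneg_right (by rw [hD]; linarith) (Real.exp_pos _).le
  -- STEP 3: the asymptotic constants
  obtain ⟨c₀, hc₀, hsurv⟩ := hS
  set κ₂ : ℝ := Real.log (c₀ / (2 * D)) with hκ₂
  set Q : ℝ := bigLam ε₀ * (1 + ε₀) * Real.exp (-(L₁ / ρ)) with hQ
  have hQ0 : 0 ≤ Q := by positivity
  have hQ1 : Q < 1 := by
    have e : Q = Real.exp (Real.log (bigLam ε₀) + ℓ - L₁ / ρ) := by
      rw [Real.exp_sub, Real.exp_add, Real.exp_log hΛ, hℓ, Real.exp_log h1ε, hQ, Real.exp_neg, div_eq_mul_inv]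
      ring
    rw [e]
    refine Real.exp_lt_one_iff.2 ?_
    rw [hlogΛ]
    have : 7 / 2 * ℓ < L₁ / ρ := by rw [lt_div_iff₀ hρ0]; linarith
    linarith
  set M₀ : ℝ := 8 * fluxConst α * (K * Real.sqrt K) * Real.exp (-(κ₂ / ρ)) with hM₀
  have hT : Tendsto (fun k : ℕ => M₀ * Q ^ k) atTop (𝓝 0) := by
    have := (tendsto_pow_atTop_nhds_zero_of_lt_one hQ0 hQ1).const_mul M₀
    simpa only [mul_zero] using this
  obtain ⟨N₁, hN₁⟩ := Filter.eventually_atTop.1 (hT.eventually (gt_mem_nhds hc₀))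
  obtain ⟨N₂, hN₂⟩ := exists_nat_ge (-κ₂ / L₁)
  set N : ℕ := max (max N₁ N₂) 1 with hN
  obtain ⟨n, hnN, σs, hσs, hcle⟩ := hsurv N
  have hnN₁ : N₁ ≤ n := le_trans (le_trans (le_max_left _ _) (le_max_left _ _)) hnN
  have hnN₂ : N₂ ≤ n := le_trans (le_trans (le_max_right _ _) (le_max_left _ _)) hnN
  have hn1 : 1 ≤ n := le_trans (le_max_right _ _) hnN
  have hσs0 : 0 ≤ σs := le_trans (Nat.cast_nonneg N) hσs
  -- survival in energy form: `c₀ ≤ (1+ε₀)ⁿ E_n(σ⋆)`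
  have hEs : c₀ ≤ (1 + ε₀) ^ n * physEnergy ε₀ W n σs := by
    rw [← wtEnergy_eq hε W n σs]; exact hcle
  have hpow : 0 < (1 + ε₀) ^ n := by positivity
  have hθn : 0 < θ ^ n := pow_pos hθ0 n
  -- the growth time `σ_m` of shell `n`
  set σm : ℝ := ((n : ℝ) * L₁ + κ₂) / ρ with hσm
  have hnum : 0 ≤ (n : ℝ) * L₁ + κ₂ := by
    have h1 : -κ₂ / L₁ ≤ (n : ℝ) := hN₂.trans (by exact_mod_cast hnN₂)
    rw [div_le_iff₀ hL₁0] at h1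
    linarith
  have hσm0 : 0 ≤ σm := div_nonneg hnum hρ0.le
  have hexpσm : D * Real.exp (ρ * σm) = θ ^ n * (c₀ / 2 / (1 + ε₀) ^ n) := by
    have e1 : ρ * σm = (n : ℝ) * L₁ + κ₂ := by rw [hσm]; field_simp
    have e2 : Real.exp L₁ = θ / (1 + ε₀) := by
      rw [hL₁, Real.exp_sub, Real.exp_log hθ0, hℓ, Real.exp_log h1ε]
    have e3 : Real.exp κ₂ = c₀ / (2 * D) := by rw [hκ₂, Real.exp_log (by positivity)]
    rw [e1, Real.exp_add, Real.exp_nat_mul, e2, e3, div_pow]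
    field_simp
  have hearly : ∀ σ, 0 ≤ σ → σ ≤ σm → physEnergy ε₀ W n σ ≤ c₀ / 2 / (1 + ε₀) ^ n := by
    intro σ h0 hm
    have h1 := hgrowth n σ h0
    have h2 : D * Real.exp (ρ * σ) ≤ D * Real.exp (ρ * σm) :=
      mul_le_mul_of_nonneg_left (Real.exp_le_exp.2 (mul_le_mul_of_nonneg_left hm hρ0.le)) hD0.le
    rw [hexpσm] at h2
    exact le_of_mul_le_mul_left (h1.trans h2) hθn
  rcases le_or_gt σs σm with hcase | hcase
  · -- the surviving event happens before the growth law allows it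
    have h1 := hearly σs hσs0 hcase
    have h2 : (1 + ε₀) ^ n * physEnergy ε₀ W n σs ≤ c₀ / 2 := by
      calc (1 + ε₀) ^ n * physEnergy ε₀ W n σs ≤ (1 + ε₀) ^ n * (c₀ / 2 / (1 + ε₀) ^ n) :=
            mul_le_mul_of_nonneg_left h1 hpow.le
        _ = c₀ / 2 := by field_simp
    linarith
  · -- the surviving event happens after `σ_m`: the bond fluxes are already starved
    have h1 := hearly σm hσm0 le_rfl
    have h2 := physEnergy_late_le hε hW hc hK0.le hK hn1 hcase.le
    have hexpm : Real.exp (-σm) = Real.exp (-(κ₂ / ρ)) * Real.exp (-(L₁ / ρ)) ^ n := by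
      rw [← Real.exp_nat_mul, ← Real.exp_add, hσm]
      congr 1
      field_simp
      ring
    have hprod : bigLam ε₀ ^ n * (1 + ε₀) ^ n * Real.exp (-σm) = Real.exp (-(κ₂ / ρ)) * Q ^ n := by
      rw [hexpm, hQ, mul_pow, mul_pow]; ring
    have h3 := hN₁ n hnN₁
    have h4 : (1 + ε₀) ^ n * physEnergy ε₀ W n σs
        ≤ c₀ / 2 + 4 * fluxConst α * (K * Real.sqrt K) * (Real.exp (-(κ₂ / ρ)) * Q ^ n) := by
      have h5 : physEnergy ε₀ W n σs
          ≤ c₀ / 2 / (1 + ε₀) ^ n + 4 * fluxConst α * bigLam ε₀ ^ n * (K * Real.sqrt K) * Real.exp (-σm) := by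
        linarith
      calc (1 + ε₀) ^ n * physEnergy ε₀ W n σs
          ≤ (1 + ε₀) ^ n * (c₀ / 2 / (1 + ε₀) ^ n
              + 4 * fluxConst α * bigLam ε₀ ^ n * (K * Real.sqrt K) * Real.exp (-σm)) :=
            mul_le_mul_of_nonneg_left h5 hpow.le
        _ = c₀ / 2 + 4 * fluxConst α * (K * Real.sqrt K)
              * (bigLam ε₀ ^ n * (1 + ε₀) ^ n * Real.exp (-σm)) := by
            field_simp
        _ = _ := by rw [hprod]
    have h6 : M₀ * Q ^ n = 2 * (4 * fluxConst α * (K * Real.sqrt K) * (Real.exp (-(κ₂ / ρ)) * Q ^ n)) := by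
      rw [hM₀]; ring
    linarith

end Summit.NavierStokesRegularity.NavierStokesRegularity.Theorems.NoSurvivingEternalViscBddOne.SurvivorTailGrowth

end
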